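import Summits.CriticalPhenomena.PercolationContinuityZ3.Theorems.PercNearOneGluingNoHeavyLowerTailSimexReduction
import Summits.CriticalPhenomena.PercolationContinuityZ3.Theorems.PercNearOneGluingAdditiveGluingSetObserverLemma3
import Summits.CriticalPhenomena.PercolationContinuityZ3.Theorems.PercNearOneGluingAdditiveGluingBlockGrowth
import HarnessLib

/-!
# `NoHeavyLowerTail` (stmt-CriticalPhenomena-4575): the FREE-RELAY certificate for SIMEX / the D-cone, any number of relays

Support file (`--supports stmt-CriticalPhenomena-4575`), route task `nh-dp-commonrelay`, gen 2.  No definitions, no named facts.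

Setting: weighting `u` on the pairs of `Fin n`, relays `A ∋ b`, designated relay `a₀ ∈ A`, competitors `A' = A ∖ {a₀, b}`, block
`S` (its cluster `K_S = ⋃_{v ∈ S} C(v)` in the UN-glued graph), and the capture event `CAP = {K_S ∩ A' ≠ ∅, a₀ ∉ K_S}`.
The registered stub `stub_simex` (SIMEX, `μ((a₀↔b) ∩ CAP) ≤ μ((S↔b) ∩ CAP)`, glued form) implies the D-cone and the crux
(`dcone_of_simex`, `noHeavyLowerTail_of_simex`).  Every proof step in the tree is a two-cluster exchange `a₀ → c` for ONE
competitor `c` (`SandwichSet.lemma3_sandwich_set`); this file records what ONE such exchange gives towards SIMEX when it is run on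
the WHOLE capture event (a legitimate sandwich family: it contains every capture of `c` avoiding `a₀`):

* `simexU_of_freeRelay` (**free-relay certificate**, un-glued form): if for SOME competitor `c ∈ A'` with `μ(a₀ ↔ b) ≤ μ(c ↔ b)`
  the free relay `c` does not beat the block on the part of `CAP` where `c` is NOT captured,
  `Δ_c := μ((c ↔ b) ∩ CAP ∩ (S ↮ c)) − μ((S ↔ b) ∩ CAP ∩ (S ↮ c)) ≤ 0`,
  then SIMEX holds: `μ((a₀ ↔ b) ∩ CAP) ≤ μ((S ↔ b) ∩ CAP)`.  Only the comparison of `a₀` with that one `c` is used.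
  Proof: sandwich exchange `a₀ → c` on `CAP`, then split `{c ↔ b} ∩ CAP` along `c ∈ K_S` (captured: `c ↔ b` puts `b` in `K_S`;
  free: the hypothesis).
* `simex_glue_lhs/rhs`: the SIMEX events do not feel the gluing of `S` (`stub_gluePushforward`, `stub_glueReach`), so the same
  certificate gives the glued instance (`simex_of_freeRelay`) and, by `dKernel_of_simex_instance`, the D-cone instance
  (`dKernel_of_freeRelay`) — the block form of Kozma–Nitzan's (41) against `a₀`, for ANY number of relays.
So the D-cone / SIMEX can only fail in the ALL-TRAP regime: every free competitor `c` beats the observer's cluster on `CAP ∩ {S ↮ c}`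
(`Δ_c > 0` for all `c ∈ A'`).  For one competitor the hypothesis is vacuous-ly satisfiable (`CAP ∩ {S ↮ c} = ∅`) and the theorem is
the two-relay exchange; exact enumeration (this seat, `n ≤ 7`, `|A'| ≤ 4`): the all-trap regime is 1–4 % of random weightings and is
disjoint in samples from the failure set of Kozma–Nitzan's Theorem-2 certificate (`m_{a₀} ≤ m_{A'}`), but both can fail together in
sparse adversarial instances (b nearly isolated), where the D-cone still holds.
[cite: KozmaNitzan2024, Lemma 3 (pp. 6–7), Theorem 2 (pp. 8–9), Question 9 (p. 36); VandenbergHaggstromKahn2006, Thms 1.3–1.5]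
-/

namespace Summit.CriticalPhenomena.PercolationContinuityZ3.Theorems

open MeasureTheory Set
open Literature.Probability.LatticeModels (prodBernoulli)
open Literature.Probability.Percolation (BondConfig openConn openConnIn openGraph openCluster)
open scoped BigOperators

noncomputable section
open Classical

section SimexRouteC
open Literature.Probability.LatticeModels Literature.Probability.Percolation

variable {n : ℕ}

/-- **Free-relay certificate for SIMEX (un-glued form).**  See the module docstring.
[cite: KozmaNitzan2024, Lemma 3 (pp. 6–7)] -/
theorem simexU_of_freeRelay (u : Sym2 (Fin n) → unitInterval) (A S : Finset (Fin n)) (b a₀ c : Fin n)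
    (hc : c ∈ (A.erase b).erase a₀)
    (hτ : (prodBernoulli u).real (openConn a₀ b) ≤ (prodBernoulli u).real (openConn c b))
    (hΔ : (prodBernoulli u).real
            ((openConn c b : Set (BondConfig (Fin n)))
              ∩ ((⋃ v ∈ S, ⋃ a ∈ (A.erase b).erase a₀, (openConn v a : Set (BondConfig (Fin n)))) ∩ ⋂ v ∈ S, (openConn v a₀)ᶜ)
              ∩ ⋂ v ∈ S, (openConn v c)ᶜ)
          ≤ (prodBernoulli u).real
            ((⋃ v ∈ S, (openConn v b : Set (BondConfig (Fin n))))
              ∩ ((⋃ v ∈ S, ⋃ a ∈ (A.erase b).erase a₀, (openConn v a : Set (BondConfig (Fin n)))) ∩ ⋂ v ∈ S, (openConn v a₀)ᶜ)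
              ∩ ⋂ v ∈ S, (openConn v c)ᶜ)) :
    (prodBernoulli u).real
        ((openConn a₀ b : Set (BondConfig (Fin n)))
          ∩ ((⋃ v ∈ S, ⋃ a ∈ (A.erase b).erase a₀, (openConn v a : Set (BondConfig (Fin n)))) ∩ ⋂ v ∈ S, (openConn v a₀)ᶜ))
      ≤ (prodBernoulli u).real
        ((⋃ v ∈ S, (openConn v b : Set (BondConfig (Fin n))))
          ∩ ((⋃ v ∈ S, ⋃ a ∈ (A.erase b).erase a₀, (openConn v a : Set (BondConfig (Fin n)))) ∩ ⋂ v ∈ S, (openConn v a₀)ᶜ)) := by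
  set μ := prodBernoulli u with hμ
  set CAP : Set (BondConfig (Fin n)) :=
    (⋃ v ∈ S, ⋃ a ∈ (A.erase b).erase a₀, (openConn v a : Set (BondConfig (Fin n)))) ∩ ⋂ v ∈ S, (openConn v a₀)ᶜ with hCAP
  set SC : Set (BondConfig (Fin n)) := ⋃ v ∈ S, (openConn v c : Set (BondConfig (Fin n))) with hSC
  set SB : Set (BondConfig (Fin n)) := ⋃ v ∈ S, (openConn v b : Set (BondConfig (Fin n))) with hSB
  have hms : ∀ s : Set (BondConfig (Fin n)), MeasurableSet s := fun s => (Set.toFinite s).measurableSet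
  -- the sandwich family: capture some competitor, avoid `a₀`
  set 𝓕 : Set (Set (Fin n)) := {T | (∃ a ∈ (A.erase b).erase a₀, a ∈ T) ∧ a₀ ∉ T} with h𝓕
  have hQ : {ω : BondConfig (Fin n) | (⋃ o ∈ S, openCluster ω o) ∈ 𝓕} = CAP := by
    ext ω
    simp only [h𝓕, hCAP, Set.mem_setOf_eq, Set.mem_inter_iff, Set.mem_iUnion, Set.mem_iInter, Set.mem_compl_iff,
      exists_prop]
    constructor
    · rintro ⟨⟨a, ha, v, hv, hva⟩, hna⟩
      exact ⟨⟨v, hv, a, ha, hva⟩, fun v hv hva => hna ⟨v, hv, hva⟩⟩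
    · rintro ⟨⟨v, hv, a, ha, hva⟩, hna⟩
      exact ⟨⟨a, ha, v, hv, hva⟩, fun ⟨v, hv, hva⟩ => hna v hv hva⟩
  have hcA' := hc
  have hlo : ∀ ω : BondConfig (Fin n), c ∈ (⋃ o ∈ S, openCluster ω o) → a₀ ∉ (⋃ o ∈ S, openCluster ω o) →
      (⋃ o ∈ S, openCluster ω o) ∈ 𝓕 := fun ω h1 h2 => ⟨⟨c, hcA', h1⟩, h2⟩
  have hhi : ∀ ω : BondConfig (Fin n), (⋃ o ∈ S, openCluster ω o) ∈ 𝓕 → a₀ ∉ (⋃ o ∈ S, openCluster ω o) :=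
    fun ω h => h.2
  have hsand := SandwichSet.lemma3_sandwich_set u a₀ c b S 𝓕 hlo hhi hτ
  rw [hQ] at hsand
  -- split `{c ↔ b} ∩ CAP` along `c ∈ K_S`
  have hsplit : μ.real ((openConn c b : Set (BondConfig (Fin n))) ∩ CAP) =
      μ.real ((openConn c b : Set (BondConfig (Fin n))) ∩ CAP ∩ SC) + μ.real (((openConn c b : Set (BondConfig (Fin n))) ∩ CAP) \ SC) :=
    (measureReal_inter_add_sdiff (hms SC) (measure_ne_top _ _)).symm
  have hsplitB : μ.real (SB ∩ CAP) = μ.real (SB ∩ CAP ∩ SC) + μ.real ((SB ∩ CAP) \ SC) :=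
    (measureReal_inter_add_sdiff (hms SC) (measure_ne_top _ _)).symm
  -- captured part: `c ∈ K_S` and `c ↔ b` put `b` in `K_S`
  have h1 : (openConn c b : Set (BondConfig (Fin n))) ∩ CAP ∩ SC ⊆ SB ∩ CAP ∩ SC := by
    rintro ω ⟨⟨hcb, hcap⟩, hSc⟩
    refine ⟨⟨?_, hcap⟩, hSc⟩
    simp only [hSC, Set.mem_iUnion, exists_prop] at hSc
    obtain ⟨v, hv, hvc⟩ := hSc
    simp only [hSB, Set.mem_iUnion, exists_prop]
    exact ⟨v, hv, blockGrowth_openConn_trans hvc hcb⟩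
  -- free part: the hypothesis (rewrite `\ SC` as `∩ ⋂ (openConn v c)ᶜ`)
  have hdiff : ∀ X : Set (BondConfig (Fin n)), X \ SC = X ∩ ⋂ v ∈ S, (openConn v c : Set (BondConfig (Fin n)))ᶜ := by
    intro X; ext ω
    simp only [hSC, Set.mem_sdiff, Set.mem_inter_iff, Set.mem_iUnion, Set.mem_iInter, Set.mem_compl_iff, exists_prop,
      not_exists, not_and]
  have h2 : μ.real (((openConn c b : Set (BondConfig (Fin n))) ∩ CAP) \ SC) ≤ μ.real ((SB ∩ CAP) \ SC) := by
    rw [hdiff, hdiff]; exact hΔ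
  have e1 : μ.real ((openConn c b : Set (BondConfig (Fin n))) ∩ CAP ∩ SC) ≤ μ.real (SB ∩ CAP ∩ SC) :=
    measureReal_mono h1 (measure_ne_top _ _)
  linarith

/-- The left SIMEX event does not feel the gluing of the block. [folklore] -/
theorem simex_glue_lhs (u : Sym2 (Fin n) → unitInterval) (A S : Finset (Fin n)) (b a₀ : Fin n) :
    (prodBernoulli (fun e : Sym2 (Fin n) => if (∀ y ∈ e, y ∈ S) ∧ ¬ e.IsDiag then 1 else u e)).real
        ((⋃ v ∈ S, ⋃ a ∈ (A.erase b).erase a₀, (openConn v a : Set (BondConfig (Fin n)))) ∩ openConn a₀ b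
          ∩ ⋂ v ∈ S, (openConn v a₀)ᶜ)
      = (prodBernoulli u).real
        ((openConn a₀ b : Set (BondConfig (Fin n)))
          ∩ ((⋃ v ∈ S, ⋃ a ∈ (A.erase b).erase a₀, (openConn v a : Set (BondConfig (Fin n)))) ∩ ⋂ v ∈ S, (openConn v a₀)ᶜ)) := by
  rw [stub_gluePushforward n u S]
  congr 1
  ext ω
  simp only [Set.mem_setOf_eq, Set.mem_inter_iff, Set.mem_iUnion, Set.mem_iInter, Set.mem_compl_iff, exists_prop,
    stub_glueReach n S]
  constructor
  · rintro ⟨⟨⟨v, hv, a, ha, hva⟩, hab⟩, hna⟩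
    have hna' : ∀ v ∈ S, ω ∉ (openConn v a₀ : Set (BondConfig (Fin n))) := fun v hv h => hna v hv (Or.inl h)
    refine ⟨?_, ?_, hna'⟩
    · rcases hab with h | ⟨⟨s, hs, hs'⟩, _⟩
      · exact h
      · exact absurd (blockGrowth_openConn_symm hs') (hna' s hs)
    · rcases hva with h | ⟨_, ⟨s, hs, hsa⟩⟩
      · exact ⟨v, hv, a, ha, h⟩
      · exact ⟨s, hs, a, ha, hsa⟩
  · rintro ⟨hab, ⟨v, hv, a, ha, hva⟩, hna⟩
    refine ⟨⟨⟨v, hv, a, ha, Or.inl hva⟩, Or.inl hab⟩, ?_⟩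
    intro v hv h
    rcases h with h | ⟨_, ⟨s, hs, hsa⟩⟩
    · exact hna v hv h
    · exact hna s hs hsa

/-- The right SIMEX event does not feel the gluing of the block. [folklore] -/
theorem simex_glue_rhs (u : Sym2 (Fin n) → unitInterval) (A S : Finset (Fin n)) (b a₀ : Fin n) :
    (prodBernoulli (fun e : Sym2 (Fin n) => if (∀ y ∈ e, y ∈ S) ∧ ¬ e.IsDiag then 1 else u e)).real
        ((⋃ v ∈ S, (openConn v b : Set (BondConfig (Fin n)))) ∩ (⋃ v ∈ S, ⋃ a ∈ (A.erase b).erase a₀, openConn v a)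
          ∩ ⋂ v ∈ S, (openConn v a₀)ᶜ)
      = (prodBernoulli u).real
        ((⋃ v ∈ S, (openConn v b : Set (BondConfig (Fin n))))
          ∩ ((⋃ v ∈ S, ⋃ a ∈ (A.erase b).erase a₀, (openConn v a : Set (BondConfig (Fin n)))) ∩ ⋂ v ∈ S, (openConn v a₀)ᶜ)) := by
  rw [stub_gluePushforward n u S]
  congr 1
  ext ω
  simp only [Set.mem_setOf_eq, Set.mem_inter_iff, Set.mem_iUnion, Set.mem_iInter, Set.mem_compl_iff, exists_prop,
    stub_glueReach n S]
  constructor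
  · rintro ⟨⟨⟨v, hv, hvb⟩, ⟨v', hv', a, ha, hva⟩⟩, hna⟩
    have hna' : ∀ v ∈ S, ω ∉ (openConn v a₀ : Set (BondConfig (Fin n))) := fun v hv h => hna v hv (Or.inl h)
    refine ⟨?_, ?_, hna'⟩
    · rcases hvb with h | ⟨_, ⟨s, hs, hsb⟩⟩
      · exact ⟨v, hv, h⟩
      · exact ⟨s, hs, hsb⟩
    · rcases hva with h | ⟨_, ⟨s, hs, hsa⟩⟩
      · exact ⟨v', hv', a, ha, h⟩
      · exact ⟨s, hs, a, ha, hsa⟩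
  · rintro ⟨⟨v, hv, hvb⟩, ⟨v', hv', a, ha, hva⟩, hna⟩
    refine ⟨⟨⟨v, hv, Or.inl hvb⟩, ⟨v', hv', a, ha, Or.inl hva⟩⟩, ?_⟩
    intro w hw h
    rcases h with h | ⟨_, ⟨s, hs, hsa⟩⟩
    · exact hna w hw h
    · exact hna s hs hsa

/-- **Free-relay certificate, glued form** (an instance of `stub_simex`). [cite: KozmaNitzan2024, Lemma 3 (pp. 6–7)] -/
theorem simex_of_freeRelay (u : Sym2 (Fin n) → unitInterval) (A S : Finset (Fin n)) (b a₀ c : Fin n)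
    (hc : c ∈ (A.erase b).erase a₀)
    (hτ : (prodBernoulli u).real (openConn a₀ b) ≤ (prodBernoulli u).real (openConn c b))
    (hΔ : (prodBernoulli u).real
            ((openConn c b : Set (BondConfig (Fin n)))
              ∩ ((⋃ v ∈ S, ⋃ a ∈ (A.erase b).erase a₀, (openConn v a : Set (BondConfig (Fin n)))) ∩ ⋂ v ∈ S, (openConn v a₀)ᶜ)
              ∩ ⋂ v ∈ S, (openConn v c)ᶜ)
          ≤ (prodBernoulli u).real
            ((⋃ v ∈ S, (openConn v b : Set (BondConfig (Fin n))))
              ∩ ((⋃ v ∈ S, ⋃ a ∈ (A.erase b).erase a₀, (openConn v a : Set (BondConfig (Fin n)))) ∩ ⋂ v ∈ S, (openConn v a₀)ᶜ)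
              ∩ ⋂ v ∈ S, (openConn v c)ᶜ)) :
    (prodBernoulli (fun e : Sym2 (Fin n) => if (∀ y ∈ e, y ∈ S) ∧ ¬ e.IsDiag then 1 else u e)).real
        ((⋃ v ∈ S, ⋃ a ∈ (A.erase b).erase a₀, openConn v a) ∩ openConn a₀ b ∩ ⋂ v ∈ S, (openConn v a₀)ᶜ)
      ≤ (prodBernoulli (fun e : Sym2 (Fin n) => if (∀ y ∈ e, y ∈ S) ∧ ¬ e.IsDiag then 1 else u e)).real
        ((⋃ v ∈ S, openConn v b) ∩ (⋃ v ∈ S, ⋃ a ∈ (A.erase b).erase a₀, openConn v a)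
          ∩ ⋂ v ∈ S, (openConn v a₀)ᶜ) := by
  rw [simex_glue_lhs, simex_glue_rhs]
  exact simexU_of_freeRelay u A S b a₀ c hc hτ hΔ

/-- **The D-cone instance from the free-relay certificate** (any number of relays): if some competitor `c ∈ A ∖ {a₀, b}` is at
least as reliable as `a₀` and does not beat the block on `CAP ∩ {S ↮ c}` (`Δ_c ≤ 0`, un-glued form), then the block form of
Kozma–Nitzan's (41) holds for the designation `a₀`: `μ_{u/S}((S ↔ A) ∩ (a₀ ↔ b)) ≤ μ_{u/S}(S ↔ b)`.
[cite: KozmaNitzan2024, (41) p. 36, Lemma 3 (pp. 6–7)] -/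
theorem dKernel_of_freeRelay (u : Sym2 (Fin n) → unitInterval) (A S : Finset (Fin n)) (b a₀ c : Fin n)
    (hb : b ∈ A) (hc : c ∈ (A.erase b).erase a₀)
    (hτ : (prodBernoulli u).real (openConn a₀ b) ≤ (prodBernoulli u).real (openConn c b))
    (hΔ : (prodBernoulli u).real
            ((openConn c b : Set (BondConfig (Fin n)))
              ∩ ((⋃ v ∈ S, ⋃ a ∈ (A.erase b).erase a₀, (openConn v a : Set (BondConfig (Fin n)))) ∩ ⋂ v ∈ S, (openConn v a₀)ᶜ)
              ∩ ⋂ v ∈ S, (openConn v c)ᶜ)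
          ≤ (prodBernoulli u).real
            ((⋃ v ∈ S, (openConn v b : Set (BondConfig (Fin n))))
              ∩ ((⋃ v ∈ S, ⋃ a ∈ (A.erase b).erase a₀, (openConn v a : Set (BondConfig (Fin n)))) ∩ ⋂ v ∈ S, (openConn v a₀)ᶜ)
              ∩ ⋂ v ∈ S, (openConn v c)ᶜ)) :
    (prodBernoulli (fun e : Sym2 (Fin n) => if (∀ y ∈ e, y ∈ S) ∧ ¬ e.IsDiag then 1 else u e)).real
        ((⋃ v ∈ S, ⋃ a ∈ A, (openConn v a : Set (BondConfig (Fin n)))) ∩ openConn a₀ b)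
      ≤ (prodBernoulli (fun e : Sym2 (Fin n) => if (∀ y ∈ e, y ∈ S) ∧ ¬ e.IsDiag then 1 else u e)).real
        (⋃ v ∈ S, (openConn v b : Set (BondConfig (Fin n)))) :=
  dKernel_of_simex_instance _ A S b a₀ hb (simex_of_freeRelay u A S b a₀ c hc hτ hΔ)

end SimexRouteC

end

end Summit.CriticalPhenomena.PercolationContinuityZ3.Theorems
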